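import Summits.NavierStokesRegularity.NavierStokesRegularity.Theorems.EulerZoomLiouvillePowerGaugeEulerLiouvilleSelfSimilarEnergyEquality
import HarnessLib

/-!
# The endpoint `ρ = 1/2`: the Bernoulli flux of an exactly self-similar member is weakly divergence free
# (crux `EulerZoomLiouville.PowerGaugeEulerLiouville` = stmt-NavierStokesRegularity-19832, line `birth`, rung C1)

Route `EulerZoomLiouville` (NavierStokesRegularity).  At the energy-conserving endpoint `ρ = 1/2` (`γ = 2/5`,
`α = 3/2`) the coefficient `2 − 5γ` of the profile local energy EQUALITY
(`selfSimilar_profile_local_energy_equality`) vanishes, and the equality becomes the FLUX IDENTITY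

  `∫ (|V|² + 2P)⟪V, ∇σ⟫ + (2/5) ∫ |V|²⟪y, ∇σ⟫ = 0`   for every `σ ∈ C_c^∞(ℝ³)`,

i.e. the Bernoulli flux field `(|V|²/2 + P)V + (1/5)|V|²y` is weakly divergence free
(`selfSimilar_endpoint_flux_identity`).  With radial `σ` this is Chae–Shvydkoy's (3.2) at `α = N/2` with
EQUALITY (shell energy `=` Bernoulli flux through the shell, both signs), the input of the endpoint port of
CS13 Thm 3.1 in Seregin's weak class; the one-sided version is the lineage's profile LEI.  WHAT THIS IS NOT: not
NS regularity, not the crux, not C1 at the endpoint; a named corollary `--supports` stmt-19832. [folklore; cf.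
ChaeShvydkoy2013 §3.1 eq. (3.2)]
-/

noncomputable section

set_option linter.dupNamespace false

open MeasureTheory Set Filter Topology Metric Function TopologicalSpace
open scoped ENNReal NNReal RealInnerProductSpace

namespace Summit.NavierStokesRegularity.NavierStokesRegularity.Theorems.PowerGaugeEulerLiouville

open Literature.Analysis Literature.Analysis.FunctionSpaces Literature.Analysis.FluidPDE

/-- **Endpoint flux identity** (`ρ = 1/2`, `γ = 2/5`): for an exactly self-similar member of the power-gauged
class (crux hypotheses verbatim) and every test function `σ`,
`∫ (|V|²+2P)⟪V,∇σ⟫ + (2/5)∫|V|²⟪y,∇σ⟫ = 0`. [folklore; cf. ChaeShvydkoy2013 §3.1 eq. (3.2)] -/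
theorem selfSimilar_endpoint_flux_identity
    {u : ℝ → EuclideanSpace ℝ (Fin 3) → EuclideanSpace ℝ (Fin 3)} {p : ℝ → EuclideanSpace ℝ (Fin 3) → ℝ}
    {H : ℝ → EuclideanSpace ℝ (Fin 3) → EuclideanSpace ℝ (Fin 3) →L[ℝ] EuclideanSpace ℝ (Fin 3)} {c : ℝ≥0}
    (hsw : IsSuitableWeakSolutionOn (slab (EuclideanSpace ℝ (Fin 3)) (Iio 0) isOpen_Iio) 0 0 u p)
    (hH : HasWeakSpatialGradientOn (slab (EuclideanSpace ℝ (Fin 3)) (Iio 0) isOpen_Iio) u H)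
    (hgauge : ∀ a : ℝ, 0 < a →
      ENNReal.ofReal (a ^ (2 * (1 / 2 : ℝ))) * cknA a (0 : ℝ × EuclideanSpace ℝ (Fin 3)) u +
          ENNReal.ofReal (a ^ (1 / 2 : ℝ)) * cknE a (0 : ℝ × EuclideanSpace ℝ (Fin 3)) H +
        ENNReal.ofReal (a ^ (2 * (1 / 2 : ℝ))) * cknD a (0 : ℝ × EuclideanSpace ℝ (Fin 3)) p ≤ (c : ℝ≥0∞))
    {V : EuclideanSpace ℝ (Fin 3) → EuclideanSpace ℝ (Fin 3)} {P : EuclideanSpace ℝ (Fin 3) → ℝ}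
    (hu : ∀ τ : ℝ, τ < 0 → u τ = selfSimilarCollapse (1 / (2 + (1 / 2 : ℝ))) 0 V τ)
    (hp : ∀ τ : ℝ, τ < 0 → p τ = selfSimilarCollapsePressure (1 / (2 + (1 / 2 : ℝ))) 0 P τ)
    {σ : EuclideanSpace ℝ (Fin 3) → ℝ} (hσ : IsTestFunctionOn (⊤ : Opens (EuclideanSpace ℝ (Fin 3))) σ) :
    (∫ x, (‖V x‖ ^ 2 + 2 * P x) * ⟪V x, gradient σ x⟫) +
        (2 / 5 : ℝ) * ∫ x, ‖V x‖ ^ 2 * ⟪x, gradient σ x⟫ = 0 := by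
  have h := selfSimilar_profile_local_energy_equality (ρ := 1 / 2) (by norm_num) (by norm_num) hsw hH hgauge hu hp hσ
  have e1 : (2 - 5 * (1 / (2 + (1 / 2 : ℝ))) : ℝ) = 0 := by norm_num
  have e2 : (1 / (2 + (1 / 2 : ℝ)) : ℝ) = 2 / 5 := by norm_num
  rw [e1, zero_mul, e2] at h
  exact h.symm

end Summit.NavierStokesRegularity.NavierStokesRegularity.Theorems.PowerGaugeEulerLiouville
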